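import Literature.Barriers.Parity.SmallScalePatterns
import Literature.NumberTheory.Sieve.LinearEquationsInPrimesSingularSeries
import Literature.NumberTheory.Sieve.ParityWave0
import Mathlib.Analysis.PSeries
import HarnessLib

/-!
# Small-scale irregularity of linear patterns of primes: arithmetic progressions

Proof companion of `Literature/Barriers/Parity/SmallScalePatterns.lean` (Pandey–Woo 2024,
Theorem 5, the named fact `SmallScalePatternIrregularity`). The paper's advertised example is the
system `(x, x+y, x+2y, x+3y)` of four-term progressions (`fourAPSystem`); this file treats the
systems `apSystem k = (x, x+y, …, x+(k-1)y)` for every `k ≥ 1` and PROVES: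

* `APSystem.card_good`, `APSystem.goodCount_eq` — the local count: for a prime `p ≥ k`, exactly
  `(p-1)(p-k+1)` of the `p²` residues `(x, y) ∈ (ℤ/p)²` have `x, x+y, …, x+(k-1)y` all prime to
  `p`; hence `APSystem.localFactor_eq`: `β_p = (1 - (k-1)/p) / (1 - 1/p)^{k-1}`
  (`= p^{k-2}(p-k+1)/(p-1)^{k-1}`, the classical singular-series factor for `k`-term
  progressions), and `APSystem.localFactor_pos`: `β_p > 0` at every prime;
* `APSystem.singularProduct_pos` — `∏_p β_p > 0`: the partial products converge (the tree's
  `Literature.NumberTheory.Sieve.tendsto_singularProductPartial_holds`, Green–Tao's Lemma 1.3) and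
  are bounded below by `½ ∏_{p ≤ 8k²+7} β_p > 0` (Weierstrass product inequality with the tree's
  uniform bound `|β_p - 1| ≤ k²/p²` and `∑_{n > N} n⁻² ≤ 2/(N+1)`);
* consequences for the barrier: `SmallScalePatternIrregularity.not_smallScaleUniformity_apSystem`
  (and `…_fourAPSystem`) — the refutation of Cramér-type small-scale uniformity for `k`-term
  progressions is an unconditional consequence of the named fact (the hypothesis `∏_p β_p > 0`
  of `SmallScalePatternIrregularity.not_smallScaleUniformity` is discharged); and
  `SmallScalePatternIrregularity.exists_prime_ap` /
  `SmallScalePatternIrregularity.exists_prime_arithmetic_progression` — the fact contains the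
  Green–Tao theorem (tree statement parity.S14,
  `Literature.NumberTheory.Sieve.exists_prime_arithmetic_progression`): an over-populated box of
  side `(log X)²` inside `[X, 2X]²` is non-empty, so for every `k` and `X₀` there are
  `a, b ≥ X₀` with `a, a+b, …, a+(k-1)b` all prime.

## References

* M. Pandey, K. Woo, *Small scale distribution of linear patterns of primes*, J. London Math.
  Soc. 110 (2024) e13001, arXiv:2304.14267: §1 (p. 3: "we can instead consider primes in four
  term arithmetic progressions, and show similar irregularities in the distribution of `(x, y)`
  such that `x, x+y, x+2y, x+3y` are all prime"), Theorem 3 (`β_p`), Theorem 5.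
* B. Green, T. Tao, *Linear equations in primes*, Ann. of Math. 171 (2010), (1.6)–(1.7) and
  Lemma 1.3 (`β_p`, `∏_p β_p`).
* B. Green, T. Tao, *The primes contain arbitrarily long arithmetic progressions*, Ann. of Math.
  167 (2008), Theorem 1.1. [cite: GreenTaoAnnals2008, Theorem 1.1]
-/

noncomputable section

open Filter Finset Topology

namespace Literature.Barriers.Parity

open Literature.NumberTheory.Sieve

variable {d t : ℕ}

/-- The system `(x, x + y, …, x + (k-1)y)` on `ℤ²` counting `k`-term arithmetic progressions
(`fourAPSystem = apSystem 4`). [cite: PandeyWoo2024, §1 (p. 3)] -/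
def apSystem (k : ℕ) : Fin k → AffLinForm 2 := fun i => ⟨![1, (i : ℤ)], 0⟩

/-- The paper's example is the case `k = 4`. [cite: PandeyWoo2024, §1 (p. 3)] -/
theorem fourAPSystem_eq_apSystem : fourAPSystem = apSystem 4 := rfl

namespace APSystem

variable {k : ℕ}

/-- `ψᵢ(n) = n₀ + i n₁`. [cite: PandeyWoo2024, §1 (p. 3)] -/
theorem eval_eq (i : Fin k) (n : Fin 2 → ℤ) : (apSystem k i).eval n = n 0 + (i : ℤ) * n 1 := by
  simp [apSystem, AffLinForm.eval, Fin.sum_univ_two]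

/-- `ψᵢ(v) = v₀ + i v₁` modulo `p`. [cite: GreenTao2010, proof of Lemma 1.3] -/
theorem modEval_eq (p : ℕ) (i : Fin k) (v : Fin 2 → ZMod p) :
    (apSystem k i).modEval p v = v 0 + ((i : ℕ) : ZMod p) * v 1 := by
  simp [apSystem, AffLinForm.modEval, Fin.sum_univ_two]

/-- `(x, x+y, …, x+(k-1)y)` is a finite-complexity system of linear forms with non-negative
coefficients, i.e. in the scope of `SmallScalePatternIrregularity`.
[cite: PandeyWoo2024, §1 (p. 3) and Definition 1] -/
theorem inScope (k : ℕ) : InScope (apSystem k) := by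
  refine ⟨?_, fun i => rfl, fun i j => ?_, fun i h => ?_⟩
  · intro i j hij a b hab
    have h0 := congrFun hab 0
    have h1 := congrFun hab 1
    simp only [apSystem, Pi.smul_apply, smul_eq_mul, Matrix.cons_val_zero,
      Matrix.cons_val_one, mul_one] at h0 h1
    subst h0
    have hij' : (i : ℤ) ≠ (j : ℤ) := by
      intro e; apply hij; ext; exact_mod_cast e
    have : a * ((i : ℤ) - (j : ℤ)) = 0 := by linarith
    rcases mul_eq_zero.1 this with ha | hsub
    · exact ⟨ha, ha⟩
    · exact absurd (sub_eq_zero.1 hsub) hij'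
  · fin_cases j <;> simp [apSystem]
  · have := congrFun h 0
    simp [apSystem] at this

/-- Hence the system satisfies Green–Tao's standing non-degeneracy hypotheses.
[cite: GreenTao2010, Def. 1.1] -/
theorem isNondegenerate (k : ℕ) : IsNondegenerateSystem (apSystem k) :=
  (inScope k).1.isNondegenerateSystem (inScope k).2.2.2

/-- The coefficients `1, i` (`i < k`) are at most `k` in absolute value (`k ≥ 1`).
[cite: GreenTao2010, (1.1)] -/
theorem natAbs_coeff_le (hk1 : 1 ≤ k) (i : Fin k) (j : Fin 2) :
    ((apSystem k i).coeff j).natAbs ≤ k := by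
  fin_cases j
  · simpa [apSystem] using hk1
  · simp [apSystem]

/-! ## The local count and the local factors `β_p` -/

/-- For a prime `p ≥ k ≥ 1` and `y ∈ ℤ/p`: the number of `x ∈ ℤ/p` with `x + i y ≠ 0` for all
`i < k` is `p - 1` if `y = 0` and `p - k` otherwise (the excluded values `-i y`, `i < k`, are
distinct). [folklore] -/
theorem card_row {p : ℕ} [hp : Fact p.Prime] (hk : k ≤ p) (hk1 : 1 ≤ k) (y : ZMod p) :
    #{x : ZMod p | ∀ i : Fin k, x + ((i : ℕ) : ZMod p) * y ≠ 0} =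
      if y = 0 then p - 1 else p - k := by
  classical
  have hset : ({x : ZMod p | ∀ i : Fin k, x + ((i : ℕ) : ZMod p) * y ≠ 0} : Finset (ZMod p)) =
      (univ.image fun i : Fin k => -(((i : ℕ) : ZMod p) * y))ᶜ := by
    ext x
    simp only [mem_filter, mem_univ, true_and, mem_compl, mem_image, not_exists]
    constructor
    · intro h i hi
      exact h i (by rw [← hi]; ring)
    · intro h i hi
      exact h i (by linear_combination (-1 : ZMod p) * hi)
  rw [hset, card_compl, ZMod.card]
  split_ifs with hy
  · subst hy
    haveI : NeZero k := ⟨by omega⟩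
    have himg : (univ.image fun i : Fin k => -(((i : ℕ) : ZMod p) * 0)) = {0} := by
      simp only [mul_zero, neg_zero]
      exact image_const univ_nonempty 0
    rw [himg, card_singleton]
  · rw [card_image_of_injective _ fun i j hij => ?_, card_univ, Fintype.card_fin]
    have h1 : (((i : ℕ) : ZMod p)) = ((j : ℕ) : ZMod p) :=
      mul_right_cancel₀ hy (neg_injective hij)
    have h2 := congrArg ZMod.val h1
    rw [ZMod.val_natCast_of_lt (lt_of_lt_of_le i.isLt hk),
      ZMod.val_natCast_of_lt (lt_of_lt_of_le j.isLt hk)] at h2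
    exact Fin.ext h2

/-- **The local count for `k`-term progressions.** For a prime `p ≥ k ≥ 1`, exactly
`(p-1)(p-k+1)` residues `(x, y) ∈ (ℤ/p)²` have `x, x+y, …, x+(k-1)y` all non-zero mod `p`
(`p - 1` with `y = 0`, and `p - k` for each of the `p - 1` non-zero `y`). [folklore] -/
theorem card_good {p : ℕ} [hp : Fact p.Prime] (hk : k ≤ p) (hk1 : 1 ≤ k) :
    #{v : ZMod p × ZMod p | ∀ i : Fin k, v.1 + ((i : ℕ) : ZMod p) * v.2 ≠ 0} =
      (p - 1) * (p - k + 1) := by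
  classical
  have h1 : #{v : ZMod p × ZMod p | ∀ i : Fin k, v.1 + ((i : ℕ) : ZMod p) * v.2 ≠ 0} =
      ∑ y : ZMod p, #{x : ZMod p | ∀ i : Fin k, x + ((i : ℕ) : ZMod p) * y ≠ 0} := by
    rw [card_filter, Fintype.sum_prod_type_right]
    simp only [card_filter]
  rw [h1]
  simp only [card_row hk hk1]
  rw [← Finset.add_sum_erase univ _ (mem_univ (0 : ZMod p)), if_pos rfl,
    sum_congr rfl fun y hy => if_neg (ne_of_mem_erase hy), sum_const, card_erase_of_mem (mem_univ _),
    card_univ, ZMod.card, smul_eq_mul]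
  ring

/-- The tree's `goodCount` (`#{v ∈ (ℤ/p)² : p ∤ ψ₁(v) ⋯ ψ_k(v)}`) for the progression system
is `(p-1)(p-k+1)` for a prime `p ≥ k ≥ 1`. [cite: GreenTao2010, proof of Lemma 1.3] -/
theorem goodCount_eq {p : ℕ} [hp : Fact p.Prime] (hk : k ≤ p) (hk1 : 1 ≤ k) :
    goodCount (apSystem k) p = (p - 1) * (p - k + 1) := by
  classical
  rw [← card_good hk hk1]
  unfold goodCount
  refine card_equiv (finTwoArrowEquiv (ZMod p)) fun v => ?_
  simp [modEval_eq]

/-- `β_p > 0` at every prime for the progression system: the residue `(1, 0)` is good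
(all forms equal `1`). [cite: GreenTao2010, (1.6)] -/
theorem localFactor_pos {p : ℕ} (hp : p.Prime) (k : ℕ) : 0 < localFactor (apSystem k) p := by
  classical
  haveI := Fact.mk hp
  have hp0 : (0 : ℝ) < p := by exact_mod_cast hp.pos
  have hp1 : (1 : ℝ) < p := by exact_mod_cast hp.one_lt
  have hgood : 0 < goodCount (apSystem k) p := by
    unfold goodCount
    refine card_pos.2 ⟨![1, 0], ?_⟩
    simp [modEval_eq]
  have hgood' : (0 : ℝ) < goodCount (apSystem k) p := by exact_mod_cast hgood
  rw [localFactor_prime]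
  exact mul_pos (by positivity) (mul_pos (pow_pos (div_pos hp0 (by linarith)) _) hgood')

/-- **`β_p` for `k`-term progressions**: for a prime `p ≥ k ≥ 1`,
`β_p = p^{-2} (p/(p-1))^k (p-1)(p-k+1) = (1 - (k-1)/p) / (1 - 1/p)^{k-1}`.
[cite: GreenTao2010, (1.6)] -/
theorem localFactor_eq {p : ℕ} (hp : p.Prime) (hk : k ≤ p) (hk1 : 1 ≤ k) :
    localFactor (apSystem k) p = (1 - ((k : ℝ) - 1) / p) / (1 - 1 / (p : ℝ)) ^ (k - 1) := by
  classical
  haveI := Fact.mk hp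
  obtain ⟨m, rfl⟩ : ∃ m, k = m + 1 := ⟨k - 1, by omega⟩
  have hp0 : (0 : ℝ) < p := by exact_mod_cast hp.pos
  have hp1 : (1 : ℝ) < p := by exact_mod_cast hp.one_lt
  rw [localFactor_prime, goodCount_eq hk hk1, Nat.add_sub_cancel]
  have h1 : ((p - 1 : ℕ) : ℝ) = (p : ℝ) - 1 := by
    rw [Nat.cast_sub hp.one_le, Nat.cast_one]
  have h2 : ((p - (m + 1) + 1 : ℕ) : ℝ) = (p : ℝ) - (m + 1 : ℕ) + 1 := by
    rw [Nat.cast_add, Nat.cast_sub hk, Nat.cast_one]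
  rw [Nat.cast_mul, h1, h2]
  have hq : (p : ℝ) - 1 ≠ 0 := by linarith
  have hp0' : (p : ℝ) ≠ 0 := hp0.ne'
  have e4 : (1 : ℝ) - 1 / p = ((p : ℝ) - 1) / p := by field_simp
  have e5 : (1 : ℝ) - (((m + 1 : ℕ) : ℝ) - 1) / p = ((p : ℝ) - m) / p := by
    push_cast; field_simp; ring
  rw [e4, e5, div_pow, div_pow]
  push_cast
  field_simp
  ring

/-- The uniform form of Green–Tao's Lemma 1.3 (tree:
`Literature.NumberTheory.Sieve.abs_localFactor_sub_one_le_of_coeff_bound`, coefficients `≤ k`)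
gives `β_p ≥ 1 - k²/p²` for primes `p > 2k²`, `p ≥ 2k`. [cite: GreenTao2010, Lemma 1.3] -/
theorem localFactor_ge {p : ℕ} (hp : p.Prime) (hk1 : 1 ≤ k) (hpk : 2 * k ^ 2 < p)
    (hpt : 2 * k ≤ p) : 1 - (k : ℝ) ^ 2 / (p : ℝ) ^ 2 ≤ localFactor (apSystem k) p := by
  have h := abs_localFactor_sub_one_le_of_coeff_bound (apSystem k) (isNondegenerate k)
    (inScope k).1 (L := k) (fun i j => natAbs_coeff_le hk1 i j) hp hpk hpt
  rw [abs_le] at h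
  linarith [h.1]

/-! ## Positivity of the singular product `∏_p β_p` -/

/-- **Weierstrass product inequality**: `∏ fᵢ ≥ 1 - ∑ aᵢ` when `fᵢ ≥ 0`, `aᵢ ≥ 0` and
`fᵢ ≥ 1 - aᵢ`. [folklore] -/
theorem prod_ge_one_sub_sum {ι : Type*} (s : Finset ι) (f a : ι → ℝ)
    (hf0 : ∀ i ∈ s, 0 ≤ f i) (ha0 : ∀ i ∈ s, 0 ≤ a i) (ha : ∀ i ∈ s, 1 - a i ≤ f i) :
    1 - ∑ i ∈ s, a i ≤ ∏ i ∈ s, f i := by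
  classical
  induction s using Finset.induction_on with
  | empty => simp
  | @insert j s hj ih =>
    rw [sum_insert hj, prod_insert hj]
    have hP : 1 - ∑ i ∈ s, a i ≤ ∏ i ∈ s, f i :=
      ih (fun i hi => hf0 i (mem_insert_of_mem hi)) (fun i hi => ha0 i (mem_insert_of_mem hi))
        (fun i hi => ha i (mem_insert_of_mem hi))
    have hP0 : 0 ≤ ∏ i ∈ s, f i := prod_nonneg fun i hi => hf0 i (mem_insert_of_mem hi)
    have hA : 0 ≤ ∑ i ∈ s, a i := sum_nonneg fun i hi => ha0 i (mem_insert_of_mem hi)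
    have hfj0 := hf0 j (mem_insert_self j s)
    have haj0 := ha0 j (mem_insert_self j s)
    have haj := ha j (mem_insert_self j s)
    by_cases hcase : 1 - ∑ i ∈ s, a i ≤ 0
    · have : 0 ≤ f j * ∏ i ∈ s, f i := mul_nonneg hfj0 hP0
      linarith
    · push Not at hcase
      have h1 : (1 - a j) * (1 - ∑ i ∈ s, a i) ≤ f j * (1 - ∑ i ∈ s, a i) :=
        mul_le_mul_of_nonneg_right haj hcase.le
      have h2 : f j * (1 - ∑ i ∈ s, a i) ≤ f j * ∏ i ∈ s, f i :=
        mul_le_mul_of_nonneg_left hP hfj0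
      nlinarith [mul_nonneg haj0 hA]

/-- `∑_{N < p ≤ x, p prime} k²/p² ≤ k² · 2/(N+1)` (from `∑_{i > N} i⁻² ≤ 2/(N+1)`). [folklore] -/
theorem sum_inv_sq_primes_tail_le (k N x : ℕ) :
    ∑ p ∈ (Nat.primesLE x).filter (fun p => N < p), (k : ℝ) ^ 2 / (p : ℝ) ^ 2 ≤
      (k : ℝ) ^ 2 * (2 / ((N : ℝ) + 1)) := by
  have hsub : (Nat.primesLE x).filter (fun p => N < p) ⊆ Ioo N (x + 1) := by
    intro p hp
    simp only [mem_filter, Nat.mem_primesLE] at hp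
    simp only [mem_Ioo]
    omega
  calc ∑ p ∈ (Nat.primesLE x).filter (fun p => N < p), (k : ℝ) ^ 2 / (p : ℝ) ^ 2
        = (k : ℝ) ^ 2 * ∑ p ∈ (Nat.primesLE x).filter (fun p => N < p), ((p : ℝ) ^ 2)⁻¹ := by
          rw [mul_sum]
          exact sum_congr rfl fun p _ => by ring
    _ ≤ (k : ℝ) ^ 2 * ∑ i ∈ Ioo N (x + 1), ((i : ℝ) ^ 2)⁻¹ :=
          mul_le_mul_of_nonneg_left
            (sum_le_sum_of_subset_of_nonneg hsub fun i _ _ => by positivity) (by positivity)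
    _ ≤ (k : ℝ) ^ 2 * (2 / ((N : ℝ) + 1)) := by
          gcongr
          exact sum_Ioo_inv_sq_le N (x + 1)

/-- Head/tail splitting of the ordered product at `N ≤ x`:
`∏_{p ≤ x} β_p = ∏_{p ≤ N} β_p · ∏_{N < p ≤ x} β_p`. [cite: GreenTao2010, (1.7)] -/
theorem singularProductPartial_split (Ψ : Fin t → AffLinForm d) {N x : ℕ} (hx : N ≤ x) :
    singularProductPartial Ψ x =
      singularProductPartial Ψ N * ∏ p ∈ (Nat.primesLE x).filter (fun p => N < p), localFactor Ψ p := by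
  unfold singularProductPartial
  rw [← prod_filter_mul_prod_filter_not (Nat.primesLE x) (fun p => p ≤ N)]
  congr 1
  · congr 1
    ext p
    simp only [mem_filter, Nat.mem_primesLE]
    exact ⟨fun h => ⟨h.2, h.1.2⟩, fun h => ⟨⟨h.1.trans hx, h.2⟩, h.1⟩⟩
  · refine prod_congr ?_ fun _ _ => rfl
    ext p
    simp only [mem_filter, not_le]

/-- The threshold `N₀ = 8k² + 7`: primes `p > N₀` satisfy `p > 2k²` and `p ≥ 2k`. [folklore] -/
theorem threshold_le {p : ℕ} (hp : 8 * k ^ 2 + 7 < p) : 2 * k ^ 2 < p ∧ 2 * k ≤ p := by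
  have hkk : k ≤ k ^ 2 := Nat.le_self_pow two_ne_zero k
  constructor <;> omega

/-- **Lower bound for the partial products** beyond `N₀ = 8k² + 7`:
`∏_{p ≤ x} β_p ≥ ½ ∏_{p ≤ N₀} β_p` for `x ≥ N₀` (Weierstrass with `β_p ≥ 1 - k²/p²` and
`∑_{p > N₀} k²/p² ≤ 2k²/(N₀+1) ≤ ¼`). [cite: GreenTao2010, Lemma 1.3] -/
theorem singularProductPartial_ge (hk1 : 1 ≤ k) {x : ℕ} (hx : 8 * k ^ 2 + 7 ≤ x) :
    singularProductPartial (apSystem k) (8 * k ^ 2 + 7) / 2 ≤ singularProductPartial (apSystem k) x := by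
  set N := 8 * k ^ 2 + 7 with hN
  rw [singularProductPartial_split _ hx]
  have hA : 0 ≤ singularProductPartial (apSystem k) N := prod_nonneg fun p _ => localFactor_nonneg _ p
  have hmem : ∀ p ∈ (Nat.primesLE x).filter (fun p => N < p), p.Prime ∧ 2 * k ^ 2 < p ∧ 2 * k ≤ p := by
    intro p hp
    simp only [mem_filter, Nat.mem_primesLE] at hp
    exact ⟨hp.1.2, threshold_le hp.2⟩
  have htail : 1 / 2 ≤ ∏ p ∈ (Nat.primesLE x).filter (fun p => N < p), localFactor (apSystem k) p := by
    have hW := prod_ge_one_sub_sum ((Nat.primesLE x).filter (fun p => N < p))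
      (fun p => localFactor (apSystem k) p) (fun p => (k : ℝ) ^ 2 / (p : ℝ) ^ 2)
      (fun p _ => localFactor_nonneg _ _) (fun p _ => by positivity)
      (fun p hp => localFactor_ge (hmem p hp).1 hk1 (hmem p hp).2.1 (hmem p hp).2.2)
    have hS := sum_inv_sq_primes_tail_le k N x
    have hnum : (k : ℝ) ^ 2 * (2 / ((N : ℝ) + 1)) ≤ 1 / 2 := by
      have hN' : (N : ℝ) + 1 = 8 * (k : ℝ) ^ 2 + 8 := by rw [hN]; push_cast; ring
      rw [hN', show (k : ℝ) ^ 2 * (2 / (8 * (k : ℝ) ^ 2 + 8)) =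
        (2 * (k : ℝ) ^ 2) / (8 * (k : ℝ) ^ 2 + 8) by ring, div_le_iff₀ (by positivity)]
      nlinarith [sq_nonneg (k : ℝ)]
    linarith
  calc singularProductPartial (apSystem k) N / 2 = singularProductPartial (apSystem k) N * (1 / 2) := by ring
    _ ≤ singularProductPartial (apSystem k) N *
          ∏ p ∈ (Nat.primesLE x).filter (fun p => N < p), localFactor (apSystem k) p :=
        mul_le_mul_of_nonneg_left htail hA

/-- The partial products are positive (every `β_p > 0`). [cite: GreenTao2010, (1.7)] -/
theorem singularProductPartial_pos (k x : ℕ) : 0 < singularProductPartial (apSystem k) x :=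
  prod_pos fun _ hp => localFactor_pos (Nat.prime_of_mem_primesLE hp) k

/-- `∏_{p ≤ x} β_p → ∏_p β_p` for the progression systems: the instance of Green–Tao's
Lemma 1.3, discharged in the tree (`tendsto_singularProductPartial_holds`).
[cite: GreenTao2010, Lemma 1.3] -/
theorem tendsto_singularProductPartial (k : ℕ) :
    Tendsto (singularProductPartial (apSystem k)) atTop (𝓝 (singularProduct (apSystem k))) :=
  tendsto_singularProductPartial_holds 2 k (apSystem k) (isNondegenerate k)

/-- **`∏_p β_p > 0`** for `(x, x+y, …, x+(k-1)y)`, `k ≥ 1`: no local obstruction, and the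
limit of the partial products is at least `½ ∏_{p ≤ 8k²+7} β_p > 0`.
[cite: GreenTao2010, Lemma 1.3 and (1.6)–(1.7)] -/
theorem singularProduct_pos (hk1 : 1 ≤ k) : 0 < singularProduct (apSystem k) := by
  have hev : ∀ᶠ x in atTop, singularProductPartial (apSystem k) (8 * k ^ 2 + 7) / 2 ≤
      singularProductPartial (apSystem k) x :=
    eventually_atTop.2 ⟨8 * k ^ 2 + 7, fun x hx => singularProductPartial_ge hk1 hx⟩
  exact lt_of_lt_of_le (half_pos (singularProductPartial_pos k _))
    (ge_of_tendsto (tendsto_singularProductPartial k) hev)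

end APSystem

/-! ## Consequences for the barrier -/

/-- `∏_p β_p > 0` for the paper's example `(x, x+y, x+2y, x+3y)`. [cite: PandeyWoo2024, §1 (p. 3)] -/
theorem singularProduct_fourAPSystem_pos : 0 < singularProduct fourAPSystem := by
  rw [fourAPSystem_eq_apSystem]
  exact APSystem.singularProduct_pos (by norm_num)

/-- **Theorem 5 refutes Cramér-type small-scale uniformity for `k`-term progressions**
(`k ≥ 1`, every `lam > 1`), unconditionally in the named fact: the hypothesis `∏_p β_p > 0` of
`SmallScalePatternIrregularity.not_smallScaleUniformity` holds for `apSystem k`.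
[cite: PandeyWoo2024, Theorem 5 and §1 (p. 3)] -/
theorem SmallScalePatternIrregularity.not_smallScaleUniformity_apSystem
    (h : SmallScalePatternIrregularity) {k : ℕ} (hk1 : 1 ≤ k) {lam : ℝ} (hlam : 1 < lam) :
    ¬ SmallScaleUniformity (apSystem k) lam :=
  h.not_smallScaleUniformity (by norm_num) hk1 (APSystem.inScope k)
    (APSystem.singularProduct_pos hk1) hlam

/-- The paper's example: **no Cramér-type uniformity for prime four-term progressions in boxes
of side `(log X)^λ`, `λ > 1`** (given the named fact). [cite: PandeyWoo2024, §1 (p. 3) and Theorem 5] -/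
theorem SmallScalePatternIrregularity.not_smallScaleUniformity_fourAPSystem
    (h : SmallScalePatternIrregularity) {lam : ℝ} (hlam : 1 < lam) :
    ¬ SmallScaleUniformity fourAPSystem lam := by
  rw [fourAPSystem_eq_apSystem]
  exact h.not_smallScaleUniformity_apSystem (by norm_num) hlam

/-- **The fact contains the Green–Tao theorem.** From `SmallScalePatternIrregularity`: for every
`k` and every `X₀` there are `a, b ≥ X₀` with `a, a + b, …, a + (k-1)b` all prime — an
over-populated box `∏ⱼ [xⱼ, xⱼ + (log X)²]`, `x ∈ [X, 2X]²` (`X ≥ X₀`), carries at least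
`(1 + δ⁺) (log X)^{4-k} ∏_p β_p > 0` prime progressions, hence at least one.
[cite: PandeyWoo2024, Theorem 5 and §1 (p. 3)] -/
theorem SmallScalePatternIrregularity.exists_prime_ap (h : SmallScalePatternIrregularity)
    (k X₀ : ℕ) : ∃ a b : ℕ, X₀ ≤ a ∧ X₀ ≤ b ∧ ∀ i < k, (a + i * b).Prime := by
  rcases Nat.eq_zero_or_pos k with rfl | hk
  · exact ⟨X₀, X₀, le_rfl, le_rfl, fun i hi => absurd hi (Nat.not_lt_zero i)⟩
  obtain ⟨δp, δm, hδp, -, hX⟩ :=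
    h 2 k (by norm_num) hk (apSystem k) (APSystem.inScope k) 2 (by norm_num)
  obtain ⟨X, hXge, ⟨x, hx, hcount⟩, -⟩ := hX (max X₀ 2)
  have hXX₀ : X₀ ≤ X := le_trans (le_max_left _ _) hXge
  have hX2 : 2 ≤ X := le_trans (le_max_right _ _) hXge
  have hM := smallScaleMainTerm_pos (lam := 2) (APSystem.singularProduct_pos hk) hX2
  have hposR : (0 : ℝ) < primePatternCount (apSystem k) x ((Real.log X) ^ (2 : ℝ)) :=
    lt_of_lt_of_le (by nlinarith) hcount
  have hpos : 0 < primePatternCount (apSystem k) x ((Real.log X) ^ (2 : ℝ)) := by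
    exact_mod_cast hposR
  unfold primePatternCount at hpos
  obtain ⟨n, hn⟩ := card_pos.1 hpos
  rw [mem_filter] at hn
  have hbox := Fintype.mem_piFinset.1 hn.1
  have h0 : (x 0 : ℤ) ≤ n 0 := (mem_Icc.1 (hbox 0)).1
  have h1 : (x 1 : ℤ) ≤ n 1 := (mem_Icc.1 (hbox 1)).1
  have hx0 := (hx 0).1
  have hx1 := (hx 1).1
  have hn0 : ((n 0).toNat : ℤ) = n 0 := Int.toNat_of_nonneg (by omega)
  have hn1 : ((n 1).toNat : ℤ) = n 1 := Int.toNat_of_nonneg (by omega)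
  refine ⟨(n 0).toNat, (n 1).toNat, by omega, by omega, fun i hi => ?_⟩
  have hprime := hn.2 ⟨i, hi⟩
  rw [APSystem.eval_eq] at hprime
  have e : n 0 + (((⟨i, hi⟩ : Fin k) : ℕ) : ℤ) * n 1 = (((n 0).toNat + i * (n 1).toNat : ℕ) : ℤ) := by
    push_cast
    rw [hn0, hn1]
  rwa [e, Int.toNat_natCast] at hprime

/-- Hence the named fact implies the registered statement parity.S14 (Green–Tao 2008, Thm. 1.1:
the primes contain arbitrarily long arithmetic progressions; tree
`Literature.NumberTheory.Sieve.exists_prime_arithmetic_progression`, itself proved in the tree as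
`exists_prime_arithmetic_progression_holds`): a discharge of `SmallScalePatternIrregularity` is
in particular a proof of the Green–Tao theorem. [cite: PandeyWoo2024, Theorem 5 and §1 (p. 3)]
[cite: GreenTaoAnnals2008, Theorem 1.1] -/
theorem SmallScalePatternIrregularity.exists_prime_arithmetic_progression
    (h : SmallScalePatternIrregularity) :
    Literature.NumberTheory.Sieve.exists_prime_arithmetic_progression := fun k => by
  obtain ⟨a, b, -, hb, hab⟩ := h.exists_prime_ap k 1
  exact ⟨a, b, hb, hab⟩

end Literature.Barriers.Parity
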